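import Mathlib
import Literature.RepresentationTheory.AlgebraicGroups.HilbertMumfordTensorWeights
import Literature.RepresentationTheory.AlgebraicGroups.HilbertMumfordTensorValuation
import Literature.Computability.AlgebraicComplexity.QuantumFunctionalsFree
import Literature.Computability.AlgebraicComplexity.QuantumFunctionalsDegenerationProofs
import HarnessLib

/-!
# Hilbert–Mumford for `SL_m(ℂ)³` on `3`-tensors, IV: cells of the monomial torus

Fourth file of the proof of `Kempf1978_thm14_tensor`; theorems only, over a valued field
`(L, O)` with residue map `red : O → κ`.

Given the monomial Cartan decomposition `Γ⁽ᵖ⁾ = P⁽ᵖ⁾ · diag(π^{n⁽ᵖ⁾}) · Q⁽ᵖ⁾` of the generic point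
(file II) and the integrality of the generic translate `t = Γ·v ∈ O^{ι³}` (file I), the tensor
`x = diag(π^{n})·(Q·v) = P⁻¹·t` is integral, and on each cell `(a,b,c)` with monomial
`δ = π^{E}`, `E = n⁽⁰⁾_a + n⁽¹⁾_b + n⁽²⁾_c`:

* `residue_eq_zero_of_mul_eq_of_not_mem` — if `δ ∉ O` then `u = (Q·v)_{abc}` reduces to `0`;
* `residue_eq_zero_of_mul_eq_of_inv_not_mem` — if `δ` is a non-unit of `O` then `x_{abc}`
  reduces to `0`;
* (`δ` a unit forces `E = 0` by valuation-independence, whence `δ = 1` and `x_{abc} = u_{abc}`.)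

Also: `actTensor_diagonal_monomial` (the diagonal monomial torus acts on a cell by `π^{E}`) and
`map_nonsing_inv_mul_map` (inverses of unimodular `O`-matrices survive in `L`).
-/

noncomputable section

open Matrix
open scoped BigOperators

namespace Literature.RepresentationTheory.AlgebraicGroups

open Literature.Computability.AlgebraicComplexity

variable {L : Type*} [Field L] (O : ValuationSubring L)

/-- If `δ ∉ O` and `δ · u = x` with `u, x ∈ O`, then `u` is not a unit of `O`, i.e. reduces to `0`
in the residue field. [folklore] -/
theorem residue_eq_zero_of_mul_eq_of_not_mem {δ : L} (hδ : δ ∉ O) (u x : O)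
    (h : δ * (u : L) = x) : IsLocalRing.residue O u = 0 := by
  by_contra hu
  have hunit : IsUnit u := (IsLocalRing.residue_ne_zero_iff_isUnit u).mp hu
  obtain ⟨y, hy⟩ := hunit.exists_right_inv
  have hδ' : δ = (x : L) * (y : L) := by
    have : ((u : O) : L) * (y : L) = 1 := by exact_mod_cast hy
    calc δ = δ * (((u : O) : L) * (y : L)) := by rw [this, mul_one]
      _ = (x : L) * (y : L) := by rw [← mul_assoc, h]
  exact hδ (hδ' ▸ mul_mem x.2 y.2)

/-- If `δ ∈ O` is not a unit (`δ⁻¹ ∉ O`) and `δ · u = x` with `u, x ∈ O`, then `x` lies in the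
maximal ideal, i.e. reduces to `0`. [folklore] -/
theorem residue_eq_zero_of_mul_eq_of_inv_not_mem {δ : L} (hδ : δ ∈ O) (hδ' : δ⁻¹ ∉ O) (u x : O)
    (h : δ * (u : L) = x) : IsLocalRing.residue O x = 0 := by
  rw [IsLocalRing.residue_eq_zero_iff]
  have hx : x = (⟨δ, hδ⟩ : O) * u := Subtype.ext (by
    show (x : L) = δ * (u : L)
    exact h.symm)
  rw [hx]
  refine Ideal.mul_mem_right _ _ ((IsLocalRing.mem_maximalIdeal _).mpr fun hunit => hδ' ?_)
  obtain ⟨y, hy⟩ := hunit.exists_right_inv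
  have : (y : L) = δ⁻¹ := by
    have hyδ : δ * (y : L) = 1 := by
      have := congr_arg (fun t : O => (t : L)) hy
      simpa using this
    have hδ0 : δ ≠ 0 := fun h0 => by rw [h0, zero_mul] at hyδ; exact zero_ne_one hyδ
    field_simp
    rw [mul_comm]
    exact hyδ
  exact this ▸ y.2

/-- The diagonal monomial torus acts on the cell `(a,b,c)` by the monomial `π^{n₀ a + n₁ b + n₂ c}`.
[folklore] -/
theorem actTensor_diagonal_monomial {ι : Type*} [Fintype ι] [DecidableEq ι] {r : ℕ}
    (π : Fin r → L) (hπ : ∀ j, π j ≠ 0) (n₀ n₁ n₂ : ι → Fin r → ℤ) (t : ι → ι → ι → L)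
    (a b c : ι) :
    actTensor (diagonal fun a => ∏ j, π j ^ n₀ a j) (diagonal fun b => ∏ j, π j ^ n₁ b j)
      (diagonal fun c => ∏ j, π j ^ n₂ c j) t a b c =
      (∏ j, π j ^ (n₀ a j + n₁ b j + n₂ c j)) * t a b c := by
  rw [actTensor_diagonal_apply, prod_zpow_add π hπ, prod_zpow_add π hπ]

/-- Unimodular matrices over `O` stay invertible in `L`: `(P⁻¹)^L · P^L = 1`. [folklore] -/
theorem map_nonsing_inv_mul_map {ι : Type*} [Fintype ι] [DecidableEq ι] (P : Matrix ι ι O)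
    (hP : P.det = 1) : P⁻¹.map O.subtype * P.map O.subtype = 1 := by
  rw [← RingHom.mapMatrix_apply, ← RingHom.mapMatrix_apply, ← map_mul,
    Matrix.nonsing_inv_mul _ (by rw [hP]; exact isUnit_one), map_one]

/-- … and `P^L · (P⁻¹)^L = 1`. [folklore] -/
theorem map_mul_map_nonsing_inv {ι : Type*} [Fintype ι] [DecidableEq ι] (P : Matrix ι ι O)
    (hP : P.det = 1) : P.map O.subtype * P⁻¹.map O.subtype = 1 := by
  rw [← RingHom.mapMatrix_apply, ← RingHom.mapMatrix_apply, ← map_mul,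
    Matrix.mul_nonsing_inv _ (by rw [hP]; exact isUnit_one), map_one]

/-- Reduction of `O`-matrices is compatible with the inverse of a unimodular matrix:
`red(P⁻¹) · red(P) = 1`. [folklore] -/
theorem map_residue_nonsing_inv_mul {ι : Type*} [Fintype ι] [DecidableEq ι] (P : Matrix ι ι O)
    (hP : P.det = 1) :
    P⁻¹.map (IsLocalRing.residue O) * P.map (IsLocalRing.residue O) = 1 := by
  rw [← RingHom.mapMatrix_apply, ← RingHom.mapMatrix_apply, ← map_mul,
    Matrix.nonsing_inv_mul _ (by rw [hP]; exact isUnit_one), map_one]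

/-- Determinants of reductions of unimodular matrices. [folklore] -/
theorem det_map_residue_eq_one {ι : Type*} [Fintype ι] [DecidableEq ι] (P : Matrix ι ι O)
    (hP : P.det = 1) : (P.map (IsLocalRing.residue O)).det = 1 := by
  rw [← RingHom.mapMatrix_apply, ← RingHom.map_det, hP, map_one]

/-- Determinant of the reduction of the inverse of a unimodular matrix. [folklore] -/
theorem det_map_residue_nonsing_inv_eq_one {ι : Type*} [Fintype ι] [DecidableEq ι]
    (P : Matrix ι ι O) (hP : P.det = 1) : (P⁻¹.map (IsLocalRing.residue O)).det = 1 := by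
  rw [← RingHom.mapMatrix_apply, ← RingHom.map_det, Matrix.det_nonsing_inv, hP, Ring.inverse_one,
    map_one]

end Literature.RepresentationTheory.AlgebraicGroups
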